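import Mathlib
import Summits.Ventures.HodgeRepro.Tier4.Line4.CentreCocompactAniso

/-!
# Tier4/Line4/CentreScalar — a CENTRAL element of `U(W)(𝔸)` is an `E′`-scalar `x · 1 + y · Ω` (C-L4-B-EXTEND, part 9a
= the first half of V-B7 of the (B) row census)

Blind re-derivation cell `pub-hodge-repro`, Tier 4 «prove the step» (README §9–§10), seat t4-x2 (reserve
wall-breaker, gen 6; GO S16576).  Tree path `lean/Summits/Ventures/HodgeRepro/Tier4/Line4/CentreScalar.lean`.
Imports: Mathlib + `Tier4/Line4/CentreCocompactAniso` (L4-p2, p720362; its `TorusData` construction on an anisotropic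
genuine plane is repeated here verbatim, and its chain `exists_pair_of_mem` → `eq_of_tmat_comm_reflConj` →
`tmat_eq_scalar_of_eq` is cut out as a standalone statement).  No definition, no instance, no printed theorem proved.

* `exists_scalar_of_mem_centre` — on an anisotropic genuine plane, every `z ∈ Z(𝔸)` has matrix `x • 1 + y • adMat Ω`
  for some adeles `x`, `y` (L4-p2's reading: a central `z` is `tmat ρ` for a norm-one pair, commutes with the rational
  unitary reflection in `v + w`, which forces the two scalars of `ρ` to be equal).
Nothing here says anything about the status of the Hodge conjecture for CM abelian varieties, which is NOT proved;
HC_CM is NOT proved by anyone in this repository.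
-/

set_option autoImplicit false

noncomputable section

namespace Summit.Ventures.HodgeRepro.Tier4.Line4

open Matrix Summit.Ventures.HodgeRepro.Tier4.Common Summit.Ventures.HodgeRepro.Tier4.Line1
  Summit.Ventures.HodgeRepro.Tier4.Line1.Rot
open scoped Pointwise

variable {k : Type} [Field k] [NumberField k] {W : PlaneData k}

/-- **A central element is an `E′`-scalar** (anisotropic genuine plane): `GA.mat W z = x • 1 + y • adMat Ω`. -/
theorem exists_scalar_of_mem_centre (hg : IsGenuineRow W) (hA : IsAnisotropic W) {z : GA W} (hz : z ∈ centre W) :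
    ∃ x y : Ad k, GA.mat W z = x • (1 : M4 k) + y • adMat k W.Ω := by
  classical
  have hP : ProjPair W W.P := projPair_P W hg
  obtain ⟨⟨d, hΩ, hd⟩, hrow, -, -, -, -⟩ := hg
  obtain ⟨v, hv, hv0⟩ := exists_row_ne_zero (hP.rank 0) (hP.idem 0)
  obtain ⟨w, hw, hw1⟩ := exists_row_ne_zero (hP.rank 1) (hP.idem 1)
  set D : TorusData k :=
    {
      B := W.B,
      Om := W.Ωᵀ,
      P := (W.P 0)ᵀ,
      d := d,
      v := v,
      w := w,
      hB := W.B_symm,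
      hherm := by rw [Matrix.transpose_transpose]; exact hrow,
      hOm := by
        rw [← Matrix.transpose_mul, hΩ, Matrix.transpose_neg, Matrix.transpose_smul, Matrix.transpose_one],
      hd := hd,
      hdef := fun u hu h => hA ⟨u, hu, h⟩,
      hv := hv,
      hw := hw,
      hwv := by
        have hv' : (W.P 0)ᵀ *ᵥ v = v := by rw [mulVec_transpose]; exact hv0
        have hw' : (W.P 1)ᵀ *ᵥ w = w := by rw [mulVec_transpose]; exact hw1
        rw [pair_comm W.B_symm]
        exact hP.pair_eq_zero hv' hw',
      hwOv := by
        have hv' : (W.P 0)ᵀ *ᵥ v = v := by rw [mulVec_transpose]; exact hv0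
        have hw' : (W.P 1)ᵀ *ᵥ w = w := by rw [mulVec_transpose]; exact hw1
        rw [pair_comm W.B_symm]
        exact hP.pair_eq_zero (hP.mulVec_Ω 0 hv') hw',
      hPv := by rw [mulVec_transpose]; exact hv0,
      hPOv := by
        have hv' : (W.P 0)ᵀ *ᵥ v = v := by rw [mulVec_transpose]; exact hv0
        exact hP.mulVec_Ω 0 hv',
      hPw := by
        have hw' : (W.P 1)ᵀ *ᵥ w = w := by rw [mulVec_transpose]; exact hw1
        exact hP.mulVec_eq_zero hw',
      hPOw := by
        have hw' : (W.P 1)ᵀ *ᵥ w = w := by rw [mulVec_transpose]; exact hw1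
        exact hP.mulVec_eq_zero (hP.mulVec_Ω 1 hw') } with hDdef
  have hDB : D.B = W.B := rfl
  have hDOm : D.Om = W.Ωᵀ := rfl
  have hDP : D.P = (W.P 0)ᵀ := rfl
  have hDd : D.d = d := rfl
  haveI := Line1.t2Space_adeleRing k
  set ι := algebraMap k (Ad k) with hι
  obtain ⟨-, -, -, -, -, hα, hα', -⟩ := D.setup (RingHom.id k)
  have hα'ne : dataAlpha' D ≠ 0 := hα'
  have hwv0 : w ⬝ᵥ (W.B *ᵥ v) = 0 := D.hwv
  have hs : dataAlpha D + dataAlpha' D ≠ 0 := by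
    have hsum : (v + w) ⬝ᵥ (W.B *ᵥ (v + w)) = dataAlpha D + dataAlpha' D := pair_add_self W.B_symm v w hwv0
    rw [← hsum]
    intro h0
    apply hA
    refine ⟨v + w, ?_, h0⟩
    intro hvw
    have hwneg : w = -v := by rw [eq_neg_iff_add_eq_zero, add_comm]; exact hvw
    apply hα
    have : w ⬝ᵥ (W.B *ᵥ v) = -(v ⬝ᵥ (W.B *ᵥ v)) := by rw [hwneg, neg_dotProduct]
    rw [hwv0] at this
    exact (neg_eq_zero.mp this.symm)
  obtain ⟨ρ, hρ, hρx⟩ := exists_pair_of_mem D hDB hDOm hDP z hz.1.1.1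
  -- central ⇒ commutes with the reflection ⇒ equal scalars
  have hcomm : D.tmat ι ρ * (reflConj D)ᵀ = (reflConj D)ᵀ * D.tmat ι ρ := by
    have hc := (Subgroup.mem_center_iff.1 hz.2) (reflElt D hDB hDOm hs)
    have := congrArg (GA.mat W) hc
    rw [GA.mat_mul, GA.mat_mul, mat_reflElt, hρx] at this
    exact this.symm
  obtain ⟨h02, h13⟩ := eq_of_tmat_comm_reflConj D hα'ne hs ρ hcomm
  refine ⟨ρ 0, ρ 1, ?_⟩
  rw [hρx]
  exact tmat_eq_scalar_of_eq D hDOm ρ h02 h13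

end Summit.Ventures.HodgeRepro.Tier4.Line4

end
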